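import Literature.AlgebraicGeometry.Resolution.AffineBlowupAlgebra
import HarnessLib

/-!
# Chart rings of a blowing up are functorial under isomorphisms of the base

Support file for crux stmt-ResolutionOfSingularities-15315
(`FrobeniusLadder.FInjectiveMacaulayfication`, line `Sketch`, seat c5): stub
`stub_reesChartCongr` (W3-6).

The blow-up engine of the crux certifies a blowing up chart by chart; the chart rings
`(R[It])_{(at)} = HomogeneousLocalization.Away (reesGrading I) (reesT a ha)`
(`Literature/AlgebraicGeometry/Resolution/AffineBlowup.lean`) are built over the literal ring of
sections `R = Γ(X₁, U)`, while the certificates (Fedder, Jacobian) are computed on a presentation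
`R ≅ R' = k[X]/(g)`. This file transports the whole chart ring along an isomorphism of the base:
a ring isomorphism `e : R ≃+* R'` with `I' = e(I)` induces
`(R[It])_{(at)} ≅ (R'[I't])_{(e(a)t)}` compatibly with the structure maps `reesChartBase`.

Proof (no grading bookkeeping): go through the affine blowup algebras
`R[I/a] ⊆ R[1/a]` (`blowupAlgebra`, `AffineBlowupAlgebra.lean`), to which the chart rings are
isomorphic over `R` (`reesChartEquiv`, `reesChartEquiv_reesChartBase`; Stacks 0804:
`D₊(a^{(1)}) = Spec R[I/a]`).

* `exists_blowupAlgebra_congr` — `e` induces `E : R[1/a] ≃+* R'[1/e(a)]` over `e`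
  (`IsLocalization.ringEquivOfRingEquiv`), with `E(1/a) = 1/e(a)`; `E` maps the generators
  `x/a`, `x ∈ I`, of `R[I/a]` to the generators `e(x)/e(a)` of `R'[I'/e(a)]` and `E⁻¹` maps them
  back (`x' ∈ e(I) ↔ e⁻¹(x') ∈ I`), so `E` restricts to `R[I/a] ≃+* R'[I'/e(a)]` over `e`;
* `stub_reesChartCongr` — compose with `reesChartEquiv` on both sides.

References: The Stacks Project, Tag 0804 (blowing up is `Proj` of the Rees algebra; the charts
`D₊(a^{(1)}) = Spec R[I/a]`), Tag 052Q (affine blowup algebras). [StacksProject]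
-/

-- single-problem summit: the doubled namespace component is forced
set_option linter.dupNamespace false

noncomputable section

namespace Summit.ResolutionOfSingularities.ResolutionOfSingularities.Theorems.FInjectiveMacaulayfication.ReesChartCongr

open Literature.AlgebraicGeometry.Resolution

universe u v

/-- **Affine blowup algebras are functorial under isomorphisms of the base**: a ring isomorphism
`e : R ≃+* R'` induces `R[I/a] ≃+* R'[e(I)/e(a)]` over `e` — the restriction of the induced
isomorphism `R[1/a] ≃+* R'[1/e(a)]` of localizations, which maps the generators `x/a`, `x ∈ I`,
onto the generators `e(x)/e(a)`. [folklore] -/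
theorem exists_blowupAlgebra_congr {R : Type u} {R' : Type v} [CommRing R] [CommRing R']
    (e : R ≃+* R') (I : Ideal R) (a : R) :
    ∃ E₀ : blowupAlgebra I a ≃+* blowupAlgebra (Ideal.map e I) (e a),
      ∀ r : R, E₀ (algebraMap R (blowupAlgebra I a) r) =
        algebraMap R' (blowupAlgebra (Ideal.map e I) (e a)) (e r) := by
  -- (1) the induced isomorphism of localizations `E : R[1/a] ≃+* R'[1/e(a)]` over `e`
  have H : (Submonoid.powers a).map e.toMonoidHom = Submonoid.powers (e a) := by
    rw [Submonoid.map_powers]; rfl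
  let E : Localization.Away a ≃+* Localization.Away (e a) :=
    IsLocalization.ringEquivOfRingEquiv (M := Submonoid.powers a) (T := Submonoid.powers (e a))
      (Localization.Away a) (Localization.Away (e a)) e H
  have hE : ∀ r : R, E (algebraMap R (Localization.Away a) r) =
      algebraMap R' (Localization.Away (e a)) (e r) := fun r =>
    IsLocalization.ringEquivOfRingEquiv_eq H r
  have hEsymm : ∀ r' : R', E.symm (algebraMap R' (Localization.Away (e a)) r') =
      algebraMap R (Localization.Away a) (e.symm r') := fun r' => by
    rw [RingEquiv.symm_apply_eq, hE, RingEquiv.apply_symm_apply]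
  -- `E (1/a) = 1/e(a)`: both are inverses of `e(a)/1`
  have hEinv : E (IsLocalization.Away.invSelf a) = IsLocalization.Away.invSelf (e a) := by
    have h1 : E (IsLocalization.Away.invSelf a) * algebraMap R' (Localization.Away (e a)) (e a) = 1 := by
      rw [← hE, ← map_mul, mul_comm, IsLocalization.Away.mul_invSelf, map_one]
    exact left_inv_eq_right_inv h1 (IsLocalization.Away.mul_invSelf (S := Localization.Away (e a)) (e a))
  have hEinv' : E.symm (IsLocalization.Away.invSelf (e a)) = IsLocalization.Away.invSelf a := by
    rw [RingEquiv.symm_apply_eq, hEinv]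
  -- (2) `E` maps `R[I/a]` into `R'[e(I)/e(a)]`, and `E⁻¹` maps back
  have hfwd : ∀ y ∈ blowupAlgebra I a, E y ∈ blowupAlgebra (Ideal.map e I) (e a) := by
    intro y hy
    induction hy using Algebra.adjoin_induction with
    | mem y hy =>
      obtain ⟨x, hx, rfl⟩ := hy
      rw [map_mul, hE, hEinv]
      exact div_mem_blowupAlgebra _ _ (Ideal.mem_map_of_mem e hx)
    | algebraMap r =>
      rw [hE]
      exact Subalgebra.algebraMap_mem _ _
    | add y z _ _ hy hz =>
      rw [map_add]
      exact Subalgebra.add_mem _ hy hz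
    | mul y z _ _ hy hz =>
      rw [map_mul]
      exact Subalgebra.mul_mem _ hy hz
  have hbwd : ∀ y' ∈ blowupAlgebra (Ideal.map e I) (e a), E.symm y' ∈ blowupAlgebra I a := by
    intro y' hy'
    induction hy' using Algebra.adjoin_induction with
    | mem y hy =>
      obtain ⟨x', hx', rfl⟩ := hy
      rw [map_mul, hEsymm, hEinv']
      exact div_mem_blowupAlgebra _ _ (Ideal.symm_apply_mem_of_equiv_iff.mpr hx')
    | algebraMap r' =>
      rw [hEsymm]
      exact Subalgebra.algebraMap_mem _ _
    | add y z _ _ hy hz =>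
      rw [map_add]
      exact Subalgebra.add_mem _ hy hz
    | mul y z _ _ hy hz =>
      rw [map_mul]
      exact Subalgebra.mul_mem _ hy hz
  -- (3) the restriction of `E`
  exact ⟨{ toFun := fun y => ⟨E y, hfwd y y.2⟩
           invFun := fun y' => ⟨E.symm y', hbwd y' y'.2⟩
           left_inv := fun y => Subtype.ext (E.symm_apply_apply y)
           right_inv := fun y' => Subtype.ext (E.apply_symm_apply y')
           map_mul' := fun y z => Subtype.ext (map_mul E y.1 z.1)
           map_add' := fun y z => Subtype.ext (map_add E y.1 z.1) }, fun r => Subtype.ext (hE r)⟩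

/-- **W3-6: the chart rings `(R[It])_{(at)}` of `Bl_I(Spec R)` are functorial under isomorphisms
of the base.** For a ring isomorphism `e : R ≃+* R'`, an ideal `I ⊆ R` and `a ∈ I`, there is a
ring isomorphism `(R[It])_{(at)} ≃+* (R'[I't])_{(e(a)t)}`, `I' = e(I)`, compatible with the
structure maps `reesChartBase` from `R` and `R'` — through the affine blowup algebras
`(R[It])_{(at)} ≅ R[I/a] ⊆ R[1/a]` (`reesChartEquiv`; Stacks 0804, `D₊(a^{(1)}) = Spec R[I/a]`)
and `exists_blowupAlgebra_congr`. [cite: StacksProject, Tag 0804] -/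
theorem stub_reesChartCongr : ∀ (R R' : Type) [CommRing R] [CommRing R'] (e : R ≃+* R') (I : Ideal R)
    (a : R) (ha : a ∈ I) (ha' : e a ∈ Ideal.map e I),
    ∃ e' : HomogeneousLocalization.Away (reesGrading I) (reesT a ha) ≃+*
        HomogeneousLocalization.Away (reesGrading (Ideal.map e I)) (reesT (e a) ha'),
      ∀ r : R, e' (reesChartBase a ha r) = reesChartBase (e a) ha' (e r) := by
  intro R R' _ _ e I a ha ha'
  obtain ⟨E₀, hE₀⟩ := exists_blowupAlgebra_congr e I a
  refine ⟨(reesChartEquiv a ha).trans (E₀.trans (reesChartEquiv (e a) ha').symm), fun r => ?_⟩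
  rw [RingEquiv.trans_apply, RingEquiv.trans_apply, reesChartEquiv_reesChartBase, hE₀,
    RingEquiv.symm_apply_eq, reesChartEquiv_reesChartBase]

end Summit.ResolutionOfSingularities.ResolutionOfSingularities.Theorems.FInjectiveMacaulayfication.ReesChartCongr

end
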